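import Summits.BirchSwinnertonDyer.BirchSwinnertonDyer.Theses.RamifiedSevenEllipticUnits
import Summits.BirchSwinnertonDyer.BirchSwinnertonDyer.Theorems.RamifiedSevenEllipticUnitsMechanismBridge
import HarnessLib

set_option linter.dupNamespace false

/-!
# Route `RamifiedSevenEllipticUnits` (rung K7r), rev 8: the split glue `EllipticUnitIndexSevenGlue`
# (IMC piece → VALUE piece → `EllipticUnitIndexSeven`) — CLOSED by the Theorems-side bridge

Cell `bsd-cm`, seat `bsd-cm-k7r-c4` (g4); planner D102/D112. HONEST FRAMING: closes the GLUE item of the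
19143 split only (pure logic over the O11 seam); BSD is not proved by any of this; the content sits in
the two children. [cite: Miller2011LMS, Def. 1.1]
-/

namespace Summit.BirchSwinnertonDyer.BirchSwinnertonDyer.Theorems

/-- **`EllipticUnitIndexSevenGlue` holds**: for every `W ∈ 𝒞₇`, (R-IMC)∃@7 and (R-PR)|IMC@7 give
(R-EU)@7 by the O11 seam (`EllipticUnitMechanismBridge.ellipticUnitIndexAt_seven_of_imc_of_value`,
definitional unfolding of the three route defs). [cite: Miller2011LMS, Def. 1.1] -/
theorem ramifiedSevenEllipticUnits_ellipticUnitIndexSevenGlue_proof :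
    Summit.BirchSwinnertonDyer.BirchSwinnertonDyer.Theses.RamifiedSevenEllipticUnits.EllipticUnitIndexSevenGlue :=
  fun h₁ h₂ =>
    Summit.BirchSwinnertonDyer.BirchSwinnertonDyer.Rank1Residual.EllipticUnitMechanismBridge.ellipticUnitIndexAt_seven_of_imc_of_value
      h₁ h₂

end Summit.BirchSwinnertonDyer.BirchSwinnertonDyer.Theorems
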